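/-
Copyright (c) 2026 the pub-hodgecm-mathlib formalisation cell (harness21).  R90-TF SLAB, section S6 «Ch14.1–5 stable TF» (Rogawski 1990, §4.1 (4.1.1), §3.1, §3.5:
the `H`-side stable class of a `G`-regular type-(1) element), prover K2E3-p17 (g12); WORK ORDER (R103) «G5 ELL-1» file 1 of 2 (S6 dealer R90-C14-plan (g3),
R90 bus 2026-09-05T04:16:30Z; census `K2/K2E3-p17/g12/CENSUS-G5-EllOneCell-payer.md` d4404f24 rows (M2)(M6)); h413 = `stmt-HodgeConjecture-24833`, route `HCCMUnconditional`.
-/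
import Literature.NumberTheory.Rogawski1990.LocalTransfer        -- ★ `IsStablyConjH`, `stableOrbitalIntegralRel`, `stableOrbitalIntegralRel_congr∕_eq_sum`, `classOrbitalIntegral`
import HarnessLib

/-!
# R90-TF ∕ S6 — G5 ELL-ONE CELL, DICTIONARY FILE: the `H`-side stable class of `(g₁, u) ∈ H = U(σ,J₂) × U(σ,J₁)` when the `U(σ,J₂)`-stable class of `g₁` is a PAIR,
# and `Φ^st((g₁,u), f) = Φ(⟦(g₁,u)⟧, f) + Φ(⟦(g₂,u)⟧, f)` (`Theorems/R90S6HeckeFLAtFrameEllOneCellDict.lean`; ns `Summit.HodgeConjecture.HodgeConjecture.R90.S6`;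
# THEOREMS ONLY, generic commutative ring `R` and involution `σ`, ★-only imports, 0 `sorry`)

WHAT (A) `Theorems/R90S6HeckeFLAtFrameOfCells.lean` (K2E3-p34 (g3)) NEEDS FROM THE ELL-1 PAYER (census (R73) d4404f24, links L2 + M6): the left side of its `hELL1` clause is
★ `stableOrbitalIntegralRel (IsLocalStablyConjH L v) mH (f^H) γH` = `∑ᶠ` over the `H_v`-classes `c` with `IsLocalStablyConjH L v γH (out c)` of ★ `classOrbitalIntegral mH f^H c`
(`Lit/Rogawski1990/LocalTransfer.lean` :106, :590; `IsLocalStablyConjH L v` is the `abbrev` of ★ `IsStablyConjH σ J₂ J₁` :363 = COMPONENTWISE stable conjugacy at the local forms).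
For `γH = (δ_θ(a,c), b)` in the type-(1) `G`-regular cell, ★ C1 p865386 `R90S6GRegularCellsU2TypeOne.isStablyConj_not_isConj_forall_deltaOne_deltaVarpi` says the `U(Φ₂)_v`-stable
class of `δ_1` is the PAIR `{[δ_1], [δ_ϖ]}` (stably conjugate, not conjugate, exhaustive).  THIS FILE turns that pair into the `H`-side class set and the two-term sum, for ANY
`R`, `σ`, `J₂`, `J₁` (so the CM dress instantiates it by `exact` at `σ := conjLocal L c v`, `J₂ := Φ₂,v`, `J₁ := Φ₁,v` — the ★ `cmDatum` carriers ARE `↥(unitaryGroup σ J)`):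
* §1 the `U(1)`-slot: `GL₁(R)` is commutative (`gl_one_mul_comm`), so ★ `IsStablyConj σ J₁ u u' ↔ u = u'` (`isStablyConj_one_iff_eq`);
* §2 conjugacy in a product is componentwise (`isConj_prod_iff`); `IsStablyConjH` is constant on conjugacy classes of its second argument (`isStablyConjH_iff_of_isConj`,
  `isStablyConjH_out_iff` — the `Quotient.out` representative of (4.1.1)'s index set is harmless);
* §3 **`setOf_isStablyConjH_out_eq_pair`**: if `g₂ ∼_st g₁` and every stable conjugate of `g₁` in `U(σ,J₂)(R)` is conjugate to `g₁` or `g₂`, then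
  `{c | IsStablyConjH σ J₂ J₁ (g₁,u) (out c)} = {⟦(g₁,u)⟧, ⟦(g₂,u)⟧}`, the two classes are distinct when `g₁ ≁ g₂` (`conjClasses_mk_prod_ne`), and the set is finite;
* §4 **`stableOrbitalIntegralRel_isStablyConjH_eq_add`**: `Φ^st((g₁,u), f) = Φ(⟦(g₁,u)⟧, f) + Φ(⟦(g₂,u)⟧, f)` (★ `finsum_mem_pair`), and the congruences
  `stableOrbitalIntegralRel_isStablyConjH_congr(_of_isConj)` (★ `stableOrbitalIntegralRel_congr`: `Φ^st` is constant on stable classes, a fortiori on conjugacy classes — the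
  (M6) «class function» glue of the census, by which the payer may replace `γH` by the literal `(δ_θ(a,c), b)` of ★ C1's conjugator head).
The CM specialisation is NOT restated here (instance search on the `cmDatum` product carriers times out outside the frame's own `letI` Borel prefix — (A) fixes those structures;
the assembly file applies §3–§4 under them by `exact`).
HONEST LABEL: count-neutral dictionary; pays no socket by itself (the ELL-1 cell of :989 needs (A) + the assembly `R90S6HeckeFLAtFrameEllOneCell` + C3 + the CM dress + (U1) +
D ED. 6); HC_CM is proved only modulo the 7 printed citations (2 remaining named inputs: hLiu418 = `stmt-HodgeConjecture-24832`, h413 = `stmt-HodgeConjecture-24833`) until rung 0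
closes; REL ≠ ★ ≠ BUILT.

## References
* [Rogawski1990] J. D. Rogawski, *Automorphic Representations of Unitary Groups in Three Variables*, Ann. of Math. Stud. 123 (1990): §4.1 (4.1.1) pp. 39–40 (`Φ^st` as the sum
  over the classes in the stable class); §3.1 p. 19 (stable conjugacy); §3.5 Prop. 3.5.2 (c) p. 29 (two classes for the rank-2 elliptic torus); §4.9 p. 54 (`H = U(2) × U(1)`).
-/

set_option autoImplicit false
set_option linter.dupNamespace false

noncomputable section

open Matrix
open scoped MatrixGroups

namespace Summit.HodgeConjecture.HodgeConjecture.R90.S6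

open Literature.NumberTheory.Rogawski1990
open Literature.NumberTheory.Automorphic
open Literature.AlgebraicGeometry.ShimuraVarieties (unitaryGroup mem_unitaryGroup_iff)

section Dict

variable {R : Type*} [CommRing R] (σ : R →+* R) (J₂ : Matrix (Fin 2) (Fin 2) R) (J₁ : Matrix (Fin 1) (Fin 1) R)

/-! ## §1 The `U(1)`-slot: `GL₁(R)` is commutative, so stable conjugacy in `U(σ, J₁)` is equality -/

/-- `GL₁(R)` is commutative (`R` commutative). [folklore] -/
theorem gl_one_mul_comm (x y : GL (Fin 1) R) : x * y = y * x := by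
  apply Units.ext
  ext i j
  fin_cases i; fin_cases j
  simp [Matrix.mul_apply, mul_comm]

/-- **Stable conjugacy in `U(σ, J₁)(R) ≤ GL₁(R)` is equality.** [cite: Rogawski1990, §3.1 p. 19] -/
theorem isStablyConj_one_iff_eq (u u' : unitaryGroup σ J₁) : IsStablyConj σ J₁ u u' ↔ u = u' := by
  constructor
  · intro h
    obtain ⟨g, hg⟩ := isStablyConj_iff.1 h
    apply Subtype.ext
    rw [← hg, gl_one_mul_comm g, mul_assoc, mul_inv_cancel, mul_one]
  · rintro rfl
    exact IsStablyConj.refl _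

/-! ## §2 Conjugacy and stable conjugacy in the product `H = U(σ, J₂) × U(σ, J₁)` -/

/-- Conjugacy in a product of groups is componentwise conjugacy. [folklore] -/
theorem isConj_prod_iff {A B : Type*} [Group A] [Group B] (x y : A × B) : IsConj x y ↔ IsConj x.1 y.1 ∧ IsConj x.2 y.2 := by
  constructor
  · intro h
    obtain ⟨c, hc⟩ := isConj_iff.1 h
    exact ⟨isConj_iff.2 ⟨c.1, congrArg Prod.fst hc⟩, isConj_iff.2 ⟨c.2, congrArg Prod.snd hc⟩⟩
  · rintro ⟨h1, h2⟩
    obtain ⟨c₁, hc₁⟩ := isConj_iff.1 h1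
    obtain ⟨c₂, hc₂⟩ := isConj_iff.1 h2
    exact isConj_iff.2 ⟨(c₁, c₂), Prod.ext hc₁ hc₂⟩

variable {σ J₂ J₁}

/-- `IsStablyConjH` is invariant under conjugation of its second argument. [cite: Rogawski1990, §3.1 p. 19] -/
theorem isStablyConjH_iff_of_isConj {a x y : unitaryGroup σ J₂ × unitaryGroup σ J₁} (h : IsConj x y) :
    IsStablyConjH σ J₂ J₁ a x ↔ IsStablyConjH σ J₂ J₁ a y :=
  ⟨fun hx => hx.trans (isStablyConjH_of_isConj h), fun hy => hy.trans (isStablyConjH_of_isConj h).symm⟩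

/-- `ConjClasses.mk (out c) = c`. [folklore] -/
theorem conjClasses_mk_out {α : Type*} [Monoid α] (c : ConjClasses α) : ConjClasses.mk (Quotient.out c) = c := by
  rw [← ConjClasses.quotient_mk_eq_mk, Quotient.out_eq]

/-- `IsStablyConjH a (out c) ↔ IsStablyConjH a x` for any representative `x` of `c`. [cite: Rogawski1990, §3.1 p. 19; §4.1 (4.1.1) p. 39] -/
theorem isStablyConjH_out_iff {a x : unitaryGroup σ J₂ × unitaryGroup σ J₁} {c : ConjClasses (unitaryGroup σ J₂ × unitaryGroup σ J₁)}
    (hx : ConjClasses.mk x = c) : IsStablyConjH σ J₂ J₁ a (Quotient.out c) ↔ IsStablyConjH σ J₂ J₁ a x :=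
  isStablyConjH_iff_of_isConj (ConjClasses.mk_eq_mk_iff_isConj.1 (by rw [conjClasses_mk_out, hx]))

/-! ## §3 THE `H`-SIDE CLASS SET of `(g₁, u)` when the `U(σ, J₂)`-stable class of `g₁` is the pair `{[g₁], [g₂]}` (★ C1's output shape) -/

/-- **THE `IsStablyConjH`-CLASS OF `(g₁, u)` MEETS EXACTLY THE TWO `H`-CLASSES `⟦(g₁, u)⟧`, `⟦(g₂, u)⟧`** when `g₂` is stably conjugate to `g₁` and every stable conjugate of
`g₁` in `U(σ, J₂)(R)` is conjugate to `g₁` or to `g₂` (the output of ★ `R90S6GRegularCellsU2TypeOne.isStablyConj_not_isConj_forall_deltaOne_deltaVarpi` for the type-(1) cell;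
the `U(1)`-slot contributes nothing: stable conjugacy there is equality, §1). [cite: Rogawski1990, §3.1 p. 19; §3.5 Prop. 3.5.2 (c) p. 29; §4.1 (4.1.1) p. 39] -/
theorem setOf_isStablyConjH_out_eq_pair {g₁ g₂ : unitaryGroup σ J₂} (hst : IsStablyConj σ J₂ g₁ g₂)
    (hall : ∀ g' : unitaryGroup σ J₂, IsStablyConj σ J₂ g₁ g' → IsConj g₁ g' ∨ IsConj g₂ g') (u : unitaryGroup σ J₁) :
    {c : ConjClasses (unitaryGroup σ J₂ × unitaryGroup σ J₁) | IsStablyConjH σ J₂ J₁ (g₁, u) (Quotient.out c)} =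
      {ConjClasses.mk (g₁, u), ConjClasses.mk (g₂, u)} := by
  ext c
  obtain ⟨x, hx⟩ := ConjClasses.exists_rep c
  rw [Set.mem_setOf_eq, isStablyConjH_out_iff hx, Set.mem_insert_iff, Set.mem_singleton_iff, ← hx, ConjClasses.mk_eq_mk_iff_isConj,
    ConjClasses.mk_eq_mk_iff_isConj]
  constructor
  · rintro ⟨h1, h2⟩
    have hu : u = x.2 := (isStablyConj_one_iff_eq σ J₁ u x.2).1 h2
    rcases hall x.1 h1 with h | h
    · exact Or.inl (IsConj.symm ((isConj_prod_iff _ _).2 ⟨h, hu ▸ IsConj.refl _⟩))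
    · exact Or.inr (IsConj.symm ((isConj_prod_iff _ _).2 ⟨h, hu ▸ IsConj.refl _⟩))
  · rintro (h | h)
    · exact isStablyConjH_of_isConj h.symm
    · exact IsStablyConjH.trans ⟨hst, IsStablyConj.refl u⟩ (isStablyConjH_of_isConj h.symm)

/-- The two classes `⟦(g₁, u)⟧ ≠ ⟦(g₂, u)⟧` are distinct when `g₁ ≁ g₂` in `U(σ, J₂)(R)`. [cite: Rogawski1990, §3.5 Prop. 3.5.2 (c) p. 29] -/
theorem conjClasses_mk_prod_ne {g₁ g₂ : unitaryGroup σ J₂} (hnc : ¬ IsConj g₁ g₂) (u : unitaryGroup σ J₁) :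
    ConjClasses.mk (g₁, u) ≠ ConjClasses.mk (g₂, u) := fun h =>
  hnc ((isConj_prod_iff _ _).1 (ConjClasses.mk_eq_mk_iff_isConj.1 h)).1

/-- The stable class of `(g₁, u)` meets FINITELY many `H`-classes (two). [cite: Rogawski1990, §3.5 Prop. 3.5.2 (c) p. 29] -/
theorem finite_setOf_isStablyConjH_out {g₁ g₂ : unitaryGroup σ J₂} (hst : IsStablyConj σ J₂ g₁ g₂)
    (hall : ∀ g' : unitaryGroup σ J₂, IsStablyConj σ J₂ g₁ g' → IsConj g₁ g' ∨ IsConj g₂ g') (u : unitaryGroup σ J₁) :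
    {c : ConjClasses (unitaryGroup σ J₂ × unitaryGroup σ J₁) | IsStablyConjH σ J₂ J₁ (g₁, u) (Quotient.out c)}.Finite := by
  rw [setOf_isStablyConjH_out_eq_pair hst hall u]
  exact (Set.finite_singleton _).insert _

/-! ## §4 THE STABLE ORBITAL INTEGRAL ON `H` AT A TWO-CLASS STABLE CLASS = THE SUM OF THE TWO CLASS ORBITAL INTEGRALS; conjugation-invariance -/

variable [∀ a : unitaryGroup σ J₂ × unitaryGroup σ J₁,
  MeasurableSpace ((unitaryGroup σ J₂ × unitaryGroup σ J₁) ⧸ Subgroup.centralizer ({a} : Set (unitaryGroup σ J₂ × unitaryGroup σ J₁)))]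

/-- **`Φ^st((g₁, u), f) = Φ(⟦(g₁, u)⟧, f) + Φ(⟦(g₂, u)⟧, f)`** — (4.1.1) on `H = U(σ, J₂) × U(σ, J₁)` at a stable class with exactly two classes (the type-(1) `G`-regular cell:
`(g₁, g₂) = (δ_1(a,c), δ_ϖ(a,c))` of ★ C1). [cite: Rogawski1990, §4.1 (4.1.1) p. 39; §3.5 Prop. 3.5.2 (c) p. 29] -/
theorem stableOrbitalIntegralRel_isStablyConjH_eq_add (mH : OrbitalMeasureFamily (unitaryGroup σ J₂ × unitaryGroup σ J₁))
    (f : unitaryGroup σ J₂ × unitaryGroup σ J₁ → ℂ) {g₁ g₂ : unitaryGroup σ J₂} (hst : IsStablyConj σ J₂ g₁ g₂) (hnc : ¬ IsConj g₁ g₂)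
    (hall : ∀ g' : unitaryGroup σ J₂, IsStablyConj σ J₂ g₁ g' → IsConj g₁ g' ∨ IsConj g₂ g') (u : unitaryGroup σ J₁) :
    stableOrbitalIntegralRel (IsStablyConjH σ J₂ J₁) mH f (g₁, u) =
      classOrbitalIntegral mH f (ConjClasses.mk (g₁, u)) + classOrbitalIntegral mH f (ConjClasses.mk (g₂, u)) := by
  rw [stableOrbitalIntegralRel, setOf_isStablyConjH_out_eq_pair hst hall u, finsum_mem_pair (conjClasses_mk_prod_ne hnc u)]

/-- **`Φ^st(γ_H, f)` is constant on the stable class of `γ_H`** (hence on its conjugacy class): ★ `stableOrbitalIntegralRel_congr`. [cite: Rogawski1990, §4.1 (4.1.1) p. 40] -/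
theorem stableOrbitalIntegralRel_isStablyConjH_congr (mH : OrbitalMeasureFamily (unitaryGroup σ J₂ × unitaryGroup σ J₁))
    (f : unitaryGroup σ J₂ × unitaryGroup σ J₁ → ℂ) {γ δ : unitaryGroup σ J₂ × unitaryGroup σ J₁} (h : IsStablyConjH σ J₂ J₁ γ δ) :
    stableOrbitalIntegralRel (IsStablyConjH σ J₂ J₁) mH f γ = stableOrbitalIntegralRel (IsStablyConjH σ J₂ J₁) mH f δ :=
  stableOrbitalIntegralRel_congr (fun _ => ⟨fun hγ => h.symm.trans hγ, fun hδ => h.trans hδ⟩) mH f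

/-- Conjugate elements of `H` have the same stable orbital integral. [cite: Rogawski1990, §4.1 (4.1.1) p. 40] -/
theorem stableOrbitalIntegralRel_isStablyConjH_congr_of_isConj (mH : OrbitalMeasureFamily (unitaryGroup σ J₂ × unitaryGroup σ J₁))
    (f : unitaryGroup σ J₂ × unitaryGroup σ J₁ → ℂ) {γ δ : unitaryGroup σ J₂ × unitaryGroup σ J₁} (h : IsConj γ δ) :
    stableOrbitalIntegralRel (IsStablyConjH σ J₂ J₁) mH f γ = stableOrbitalIntegralRel (IsStablyConjH σ J₂ J₁) mH f δ :=
  stableOrbitalIntegralRel_isStablyConjH_congr mH f (isStablyConjH_of_isConj h)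

end Dict


end Summit.HodgeConjecture.HodgeConjecture.R90.S6

end
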